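import Summits.Ventures.LatticeQCDFlow.Exactness.Phi4HMCCarreDuChamp
import HarnessLib

/-!
# The leapfrog overshoots the quartic wall, I: one qpq step from the far box raises the energy

HONEST FRAMING: exact (Metropolis-corrected) sampling algorithms for lattice gauge theory;
figures of merit are autocorrelation/cost numbers at stated couplings and volumes; no
continuum-physics claim.  (SCALAR calibration rung S0-A: not a gauge result.)

Venture `LatticeQCDFlow` (cell pub-lqcd), topic `Exactness`; FANOUT row 2 (`s0-phi4`, HMC arm).
NEW WORK of the cell over row 2's HMC files (`Phi4HMCExact`: `hmcProposal`, `phi4HmcEnergy`;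
`Scoring/FreeFieldLeapfrog`: `leapfrogQPQ`, `lfDrift`, `lfKick`; `Scoring/SchwingerDysonPhi4*`:
`latticePhi4Action`, `latticePhi4Force`, `latticePhi4Action_coercive`).  Nothing is cited as a fact.
The phenomenon — for potentials
growing faster than quadratically the leapfrog map with a FIXED step size is unstable far out, the
proposal lands at an energy far above the starting one and is rejected, so that HMC is not
geometrically ergodic for such targets — is printed for HMC on `ℝ^d` (Livingstone, Betancourt, Byrne,
Girolami, Bernoulli 25 (2019) §5; Roberts–Tweedie 1996 for the rejection-probability criterion;
Bou-Rabee–Sanz-Serna, Acta Numerica 2018, on leapfrog stability), NAMED ONLY; here it is a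
quantitative lemma about row 2's lattice φ⁴ HMC with ONE qpq leapfrog step per trajectory (the
"Langevin corner" of `Phi4HMCOneStepCSD`), every `λ > 0`, every real `J`, every step size `δ > 0`.

## What is proved (`Λ = Fin (n+1)`, `V = n+1`, `C_J = Σ_{x,y} |J_{xy}|`, box `A_t = {t ≤ φ_x ≤ 2t ∀x}`)

* `sum_abs_add_abs_le`, **`latticePhi4Force_ge_of_mem_box`** — on `{t/2 ≤ ψ ≤ 5t/2}` every force
  component is `≥ λt³/2 − 5 t C_J` (the cubic term wins);
* **`lfKick_le_of_mem_box`** — for `φ ∈ A_t`, momenta `|p_x| ≤ t/δ` and `t` large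
  (`t/δ + 5δ t C_J ≤ δλt³/4`), the kicked momentum obeys `p₁,x ≤ −δλt³/4` at EVERY site;
* `latticePhi4Action_le_of_mem_box` — `S ≤ 4 C_J t² + 16 λ V t⁴` on `A_t`;
* **`hmc_energy_gap_of_mem_box`** — the one-step proposal `Ψ = hmcProposal J λ δ 1` raises the
  energy: `H(Ψ(φ,p)) − H(φ,p) ≥ V(δλt³/4)²/2 − K₀ − 4 C_J t² − 16 λ V t⁴ − V (t/δ)²/2`
  (`K₀ = V (C_J + 1)²/(4λ)` the coercivity constant).

The acceptance bound drawn from this is `Exactness/Phi4HMCTailRejection.lean`.  NOT CLAIMED: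
`N ≥ 2` leapfrog steps; the pqp variant; adaptive step sizes.
-/

namespace Summit.Ventures.LatticeQCDFlow.Exactness

open Real MeasureTheory Filter Finset
open Summit.Ventures.LatticeQCDFlow.Scoring

section TailEnergy

variable {n : ℕ}

/-! ## §1 The cubic force wins on the shifted box -/

/-- A row/column of `|J|` is at most the total `C_J = Σ_{x,y} |J_{xy}|`. -/
theorem sum_abs_add_abs_le (J : Fin (n + 1) → Fin (n + 1) → ℝ) (x : Fin (n + 1)) :
    ∑ y, (|J x y| + |J y x|) ≤ 2 * ∑ x, ∑ y, |J x y| := by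
  rw [Finset.sum_add_distrib, two_mul]
  refine add_le_add ?_ ?_
  · exact Finset.single_le_sum (f := fun x => ∑ y, |J x y|)
      (fun x _ => Finset.sum_nonneg fun y _ => abs_nonneg _) (Finset.mem_univ x)
  · calc ∑ y, |J y x| ≤ ∑ y, ∑ z, |J y z| :=
        Finset.sum_le_sum fun y _ => Finset.single_le_sum (f := fun z => |J y z|)
          (fun z _ => abs_nonneg _) (Finset.mem_univ x)
      _ = ∑ x, ∑ y, |J x y| := rfl

/-- **The cubic term wins**: on the box `{t/2 ≤ ψ_y ≤ 5t/2 ∀y}` (`t ≥ 0`, `λ ≥ 0`) every force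
component satisfies `F_x(ψ) ≥ λ t³/2 − 5 t C_J`. -/
theorem latticePhi4Force_ge_of_mem_box {lam t : ℝ} (hlam : 0 ≤ lam) (ht : 0 ≤ t)
    (J : Fin (n + 1) → Fin (n + 1) → ℝ) (ψ : Fin (n + 1) → ℝ)
    (hψ : ∀ y, t / 2 ≤ ψ y ∧ ψ y ≤ 5 * t / 2) (x : Fin (n + 1)) :
    lam * t ^ 3 / 2 - 5 * t * ∑ x, ∑ y, |J x y| ≤ latticePhi4Force J lam ψ x := by
  unfold latticePhi4Force
  have hcube : lam * t ^ 3 / 2 ≤ 4 * lam * ψ x ^ 3 := by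
    have h1 : (t / 2) ^ 3 ≤ ψ x ^ 3 :=
      pow_le_pow_left₀ (by linarith) (hψ x).1 3
    nlinarith
  have hlin : -(5 * t * ∑ x, ∑ y, |J x y|) ≤ ∑ y, (J x y + J y x) * ψ y := by
    have hterm : ∀ y, -((|J x y| + |J y x|) * (5 * t / 2)) ≤ (J x y + J y x) * ψ y := by
      intro y
      have hy0 : 0 ≤ ψ y := le_trans (by linarith) (hψ y).1
      have habs : |(J x y + J y x) * ψ y| ≤ (|J x y| + |J y x|) * (5 * t / 2) := by
        rw [abs_mul, abs_of_nonneg hy0]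
        exact mul_le_mul (abs_add_le _ _) (hψ y).2 hy0 (add_nonneg (abs_nonneg _) (abs_nonneg _))
      linarith [neg_abs_le ((J x y + J y x) * ψ y)]
    calc -(5 * t * ∑ x, ∑ y, |J x y|) = -((5 * t / 2) * (2 * ∑ x, ∑ y, |J x y|)) := by ring
      _ ≤ -((5 * t / 2) * ∑ y, (|J x y| + |J y x|)) := by
          have := sum_abs_add_abs_le J x
          nlinarith
      _ = ∑ y, -((|J x y| + |J y x|) * (5 * t / 2)) := by
          rw [Finset.mul_sum, ← Finset.sum_neg_distrib]
          exact Finset.sum_congr rfl fun y _ => by ring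
      _ ≤ ∑ y, (J x y + J y x) * ψ y := Finset.sum_le_sum fun y _ => hterm y
  linarith

/-! ## §2 One qpq step from the far box: the kick reverses and magnifies every momentum -/

/-- **The kicked momentum is large and negative at every site.**  `φ ∈ A_t`, `|p_y| ≤ t/δ` for all
`y`, `δ > 0`, `t ≥ 0`, and `t` large in the sense `t/δ + 5δ t C_J ≤ δλt³/4`: then
`(lfKick J λ δ (φ + (δ/2)p) p)_x ≤ −δλt³/4`. -/
theorem lfKick_le_of_mem_box {lam δ t : ℝ} (hlam : 0 ≤ lam) (hδ : 0 < δ) (ht : 0 ≤ t)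
    (J : Fin (n + 1) → Fin (n + 1) → ℝ) {φ p : Fin (n + 1) → ℝ}
    (hφ : ∀ y, t ≤ φ y ∧ φ y ≤ 2 * t) (hp : ∀ y, |p y| ≤ t / δ)
    (hbig : t / δ + 5 * δ * t * (∑ x, ∑ y, |J x y|) ≤ δ * lam * t ^ 3 / 4) (x : Fin (n + 1)) :
    lfKick J lam δ (lfDrift (δ / 2) φ p) p x ≤ -(δ * lam * t ^ 3 / 4) := by
  -- the half-drifted configuration lies in the shifted box
  have hmid : ∀ y, t / 2 ≤ lfDrift (δ / 2) φ p y ∧ lfDrift (δ / 2) φ p y ≤ 5 * t / 2 := by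
    intro y
    unfold lfDrift
    have hpy := abs_le.mp (hp y)
    have h1 : -(t / 2) ≤ δ / 2 * p y := by
      have : δ / 2 * (-(t / δ)) ≤ δ / 2 * p y := mul_le_mul_of_nonneg_left hpy.1 (by linarith)
      have e : δ / 2 * (-(t / δ)) = -(t / 2) := by field_simp
      linarith
    have h2 : δ / 2 * p y ≤ t / 2 := by
      have : δ / 2 * p y ≤ δ / 2 * (t / δ) := mul_le_mul_of_nonneg_left hpy.2 (by linarith)
      have e : δ / 2 * (t / δ) = t / 2 := by field_simp
      linarith
    constructor <;> linarith [(hφ y).1, (hφ y).2]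
  have hF := latticePhi4Force_ge_of_mem_box hlam ht J _ hmid x
  unfold lfKick
  have hpx := (abs_le.mp (hp x)).2
  have hδF : δ * (lam * t ^ 3 / 2 - 5 * t * ∑ x, ∑ y, |J x y|)
      ≤ δ * latticePhi4Force J lam (lfDrift (δ / 2) φ p) x := mul_le_mul_of_nonneg_left hF hδ.le
  nlinarith

/-- The action is bounded on the box: `S(φ) ≤ 4 C_J t² + 16 λ V t⁴` for `φ ∈ A_t` (`t, λ ≥ 0`). -/
theorem latticePhi4Action_le_of_mem_box {lam t : ℝ} (hlam : 0 ≤ lam) (ht : 0 ≤ t)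
    (J : Fin (n + 1) → Fin (n + 1) → ℝ) {φ : Fin (n + 1) → ℝ} (hφ : ∀ y, t ≤ φ y ∧ φ y ≤ 2 * t) :
    latticePhi4Action J lam φ
      ≤ 4 * t ^ 2 * (∑ x, ∑ y, |J x y|) + 16 * lam * ((n : ℝ) + 1) * t ^ 4 := by
  unfold latticePhi4Action
  have h0 : ∀ y, 0 ≤ φ y := fun y => le_trans ht (hφ y).1
  have hquad : ∑ x, ∑ y, φ x * J x y * φ y ≤ 4 * t ^ 2 * ∑ x, ∑ y, |J x y| := by
    rw [Finset.mul_sum]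
    refine Finset.sum_le_sum fun x _ => ?_
    rw [Finset.mul_sum]
    refine Finset.sum_le_sum fun y _ => ?_
    have hx := (hφ x).2
    have hy := (hφ y).2
    calc φ x * J x y * φ y ≤ |φ x * J x y * φ y| := le_abs_self _
      _ = φ x * |J x y| * φ y := by rw [abs_mul, abs_mul, abs_of_nonneg (h0 x), abs_of_nonneg (h0 y)]
      _ ≤ (2 * t) * |J x y| * (2 * t) := by
          refine mul_le_mul (mul_le_mul_of_nonneg_right hx (abs_nonneg _)) hy (h0 y) ?_
          exact mul_nonneg (by linarith) (abs_nonneg _)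
      _ = 4 * t ^ 2 * |J x y| := by ring
  have hquart : lam * ∑ x, φ x ^ 4 ≤ 16 * lam * ((n : ℝ) + 1) * t ^ 4 := by
    have h4 : ∀ x, φ x ^ 4 ≤ (2 * t) ^ 4 := fun x => pow_le_pow_left₀ (h0 x) (hφ x).2 4
    calc lam * ∑ x, φ x ^ 4 ≤ lam * ∑ _x : Fin (n + 1), (2 * t) ^ 4 :=
          mul_le_mul_of_nonneg_left (Finset.sum_le_sum fun x _ => h4 x) hlam
      _ = 16 * lam * ((n : ℝ) + 1) * t ^ 4 := by
          rw [Finset.sum_const, Finset.card_univ, Fintype.card_fin, nsmul_eq_mul]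
          push_cast
          ring
  linarith

/-- **THE ONE-STEP PROPOSAL RAISES THE ENERGY.**  `λ > 0`, `δ > 0`, `t ≥ 0`, `φ ∈ A_t`,
`|p_y| ≤ t/δ ∀y`, `t/δ + 5δ t C_J ≤ δλt³/4`:
`H(Ψ(φ,p)) − H(φ,p) ≥ V (δλt³/4)²/2 − K₀ − 4 C_J t² − 16 λ V t⁴ − V (t/δ)²/2`,
`Ψ = hmcProposal J λ δ 1` (one qpq step, then flip), `K₀ = V (C_J + 1)²/(4λ)`. -/
theorem hmc_energy_gap_of_mem_box {lam δ t : ℝ} (hlam : 0 < lam) (hδ : 0 < δ) (ht : 0 ≤ t)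
    (J : Fin (n + 1) → Fin (n + 1) → ℝ) {φ p : Fin (n + 1) → ℝ}
    (hφ : ∀ y, t ≤ φ y ∧ φ y ≤ 2 * t) (hp : ∀ y, |p y| ≤ t / δ)
    (hbig : t / δ + 5 * δ * t * (∑ x, ∑ y, |J x y|) ≤ δ * lam * t ^ 3 / 4) :
    ((n : ℝ) + 1) * (δ * lam * t ^ 3 / 4) ^ 2 / 2
        - ((n : ℝ) + 1) * (((∑ x, ∑ y, |J x y|) + 1) ^ 2 / (4 * lam))
        - 4 * t ^ 2 * (∑ x, ∑ y, |J x y|) - 16 * lam * ((n : ℝ) + 1) * t ^ 4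
        - ((n : ℝ) + 1) * (t / δ) ^ 2 / 2
      ≤ phi4HmcEnergy J lam (hmcProposal J lam δ 1 (φ, p)) - phi4HmcEnergy J lam (φ, p) := by
  -- unfold the one-step proposal
  have hprop : hmcProposal J lam δ 1 (φ, p)
      = (lfDrift (δ / 2) (lfDrift (δ / 2) φ p) (lfKick J lam δ (lfDrift (δ / 2) φ p) p),
          -lfKick J lam δ (lfDrift (δ / 2) φ p) p) := by
    simp only [hmcProposal, Function.iterate_one, momFlip, leapfrogQPQ]
  set p₁ := lfKick J lam δ (lfDrift (δ / 2) φ p) p with hp₁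
  set q₁ := lfDrift (δ / 2) (lfDrift (δ / 2) φ p) p₁ with hq₁
  rw [hprop]
  unfold phi4HmcEnergy
  simp only [Pi.neg_apply, neg_sq]
  -- (a) the new kinetic energy is huge
  have hkick : ∀ x, p₁ x ≤ -(δ * lam * t ^ 3 / 4) := fun x =>
    lfKick_le_of_mem_box hlam.le hδ ht J hφ hp hbig x
  have hc0 : 0 ≤ δ * lam * t ^ 3 / 4 := by positivity
  have hkin1 : ((n : ℝ) + 1) * (δ * lam * t ^ 3 / 4) ^ 2 ≤ ∑ x, p₁ x ^ 2 := by
    have hx : ∀ x, (δ * lam * t ^ 3 / 4) ^ 2 ≤ p₁ x ^ 2 := by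
      intro x
      have h := hkick x
      nlinarith
    calc ((n : ℝ) + 1) * (δ * lam * t ^ 3 / 4) ^ 2 = ∑ _x : Fin (n + 1), (δ * lam * t ^ 3 / 4) ^ 2 := by
          rw [Finset.sum_const, Finset.card_univ, Fintype.card_fin, nsmul_eq_mul]; push_cast; ring
      _ ≤ ∑ x, p₁ x ^ 2 := Finset.sum_le_sum fun x _ => hx x
  -- (b) the new action is bounded below (coercivity)
  have hS1 : -(((n : ℝ) + 1) * (((∑ x, ∑ y, |J x y|) + 1) ^ 2 / (4 * lam)))
      ≤ latticePhi4Action J lam q₁ := by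
    have h := latticePhi4Action_coercive hlam J q₁
    have h0 : 0 ≤ ∑ w, q₁ w ^ 2 := Finset.sum_nonneg fun w _ => sq_nonneg _
    linarith
  -- (c) the old action and kinetic energy are bounded above on the box
  have hS0 := latticePhi4Action_le_of_mem_box hlam.le ht J hφ
  have hkin0 : ∑ x, p x ^ 2 ≤ ((n : ℝ) + 1) * (t / δ) ^ 2 := by
    have hx : ∀ x, p x ^ 2 ≤ (t / δ) ^ 2 := fun x => by
      have h := hp x
      rw [← sq_abs]
      exact pow_le_pow_left₀ (abs_nonneg _) h 2
    calc ∑ x, p x ^ 2 ≤ ∑ _x : Fin (n + 1), (t / δ) ^ 2 := Finset.sum_le_sum fun x _ => hx x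
      _ = ((n : ℝ) + 1) * (t / δ) ^ 2 := by
          rw [Finset.sum_const, Finset.card_univ, Fintype.card_fin, nsmul_eq_mul]; push_cast; ring
  linarith

end TailEnergy

end Summit.Ventures.LatticeQCDFlow.Exactness
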